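import Summits.CriticalPhenomena.CardyFormulaZ2.Theorems.CardyIKTransportIKMixedBoxCrossingQuenchedTotalMass

/-!
# Stub `stub_annealedQuenchedBound` — the annealed bound (A) (line `defect-closure-exploration` v7 / ALT line
# `quenched-chain-fkg`, crux `IKMixedBoxCrossing`, stmt-CriticalPhenomena-5911)

Support file (`--supports stmt-CriticalPhenomena-5911`): the registered stub
`stub_annealedQuenchedBound : QuenchedMixture → QuenchedHarris → AnnealedQuenchedBound` of `…QuenchedMixtureDefs`.
By the exact quenched mixture (M), the free colour law of the intersection `∩ 𝒜_i` of increasing families of black sets is the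
environment average `∑_D ∑_v envW S Λ D · P_{(D,v)}(∩ 𝒜_i)`; by quenched Harris–FKG (H) and the total mass
`P_{(D,v)}(Λ.powerset) = 1` (`quenchedProb_powerset`, `…QuenchedTotalMass`) each quenched probability of the intersection dominates
`∏_i P_{(D,v)}(𝒜_i)`; and the environment weights of environments carrying an admissible pattern are nonnegative (`envW_nonneg`:
`0 ≤ ρ ≤ 1`, and every local code met by an admissible pattern contains the two words `∅`, `v K`, so `1/(|V_K| − 2) ≥ 0` — for
`|V_K| = 2` by Lean's `1/0 = 0`).  Termwise comparison of the two double sums gives (A).  No new definitions.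
-/

noncomputable section

namespace Summit.CriticalPhenomena.CardyFormulaZ2.Cruxes.IKMixedBoxCrossing.QuenchedChainFKG

open scoped Classical BigOperators
open Finset
open Literature.Probability.LatticeModels
open Summit.CriticalPhenomena.CardyFormulaZ2.Cruxes.IKMixedBoxCrossing.DefectClosureExploration
  (facesIn colourLaw maskDensity tIK maskDensity_tIK ρIK_pos seven_mul_ρIK_lt_one facesIn_subset_innerVertices)

namespace AnnealedBound

/-- `0 ≤ ρ = 7 − 4√3` at the IK point. -/
theorem maskDensity_tIK_nonneg : 0 ≤ maskDensity tIK := by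
  rw [maskDensity_tIK]
  exact ρIK_pos.le

/-- `ρ ≤ 1` at the IK point (indeed `7ρ < 1`). -/
theorem maskDensity_tIK_le_one : maskDensity tIK ≤ 1 := by
  rw [maskDensity_tIK]
  linarith [ρIK_pos, seven_mul_ρIK_lt_one]

/-- The environment weight of an environment `(D, v)` carrying an admissible pattern `v` is nonnegative: `0 ≤ ρ ≤ 1` and every
local code met by `v` has at least two words, so each factor `1/(|V_K| − 2)` is `≥ 0` (`= 0` when `|V_K| = 2`). -/
theorem envW_nonneg (S : Set ℤ) (Λ : Finset (Site 2)) {D : Finset (Site 2)} {v : Finset (Site 2) → Finset (Site 2)}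
    (hv : v ∈ patterns D) : 0 ≤ envW S Λ D := by
  unfold envW
  refine mul_nonneg (mul_nonneg (pow_nonneg maskDensity_tIK_nonneg _) (pow_nonneg (sub_nonneg.2 maskDensity_tIK_le_one) _))
    (Finset.prod_nonneg fun K hK => ?_)
  have h2 : (2 : ℝ) ≤ (localCode D K).card := by exact_mod_cast TotalMass.two_le_card_localCode hv hK
  exact one_div_nonneg.2 (sub_nonneg.2 h2)

end AnnealedBound

open AnnealedBound

/-- **Registered stub `stub_annealedQuenchedBound`** (THE ANNEALED BOUND (A) from the mixture (M) and quenched Harris (H)):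
for increasing families `𝒜_i ⊆ Λ.powerset`,
`∑_D ∑_{v ∈ patterns D} envW S Λ D · ∏_i P_{(D,v)}(𝒜_i) ≤ colourLaw S Λ {boxFill Λ white s | s ∈ ∩_i 𝒜_i}`.
Proof: rewrite the right-hand side by (M) as the same double sum with `P_{(D,v)}(∩_i 𝒜_i)` in place of the product, and compare
termwise — `envW ≥ 0` (`envW_nonneg`), `∏_i P(𝒜_i) ≤ P(Λ.powerset)^{k−1} · P(∩ 𝒜_i)` by (H) for `D ⊆ facesIn S Λ ⊆ innerVertices Λ`,
and `P(Λ.powerset) = 1` (`quenchedProb_powerset`). -/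
theorem stub_annealedQuenchedBound : QuenchedMixture → QuenchedHarris → AnnealedQuenchedBound := by
  intro hM hH S Λ k 𝒜 h𝒜
  rw [hM S Λ _ (Finset.filter_subset _ _)]
  refine Finset.sum_le_sum fun D hD => Finset.sum_le_sum fun v hv => ?_
  have hDin : D ⊆ innerVertices Λ := (Finset.mem_powerset.1 hD).trans (facesIn_subset_innerVertices S Λ)
  refine mul_le_mul_of_nonneg_left ?_ (envW_nonneg S Λ hv)
  calc ∏ i, quenchedProb D Λ v (𝒜 i)
      ≤ quenchedProb D Λ v Λ.powerset ^ (k - 1) * quenchedProb D Λ v (Λ.powerset.filter fun s => ∀ i, s ∈ 𝒜 i) :=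
        hH D Λ hDin v hv k 𝒜 h𝒜
    _ = quenchedProb D Λ v (Λ.powerset.filter fun s => ∀ i, s ∈ 𝒜 i) := by
        rw [quenchedProb_powerset D Λ hDin v hv, one_pow, one_mul]

/-- Export alias of the registered stub: the annealed bound (A) from the mixture (M) and quenched Harris (H). -/
theorem annealedQuenchedBound (hM : QuenchedMixture) (hH : QuenchedHarris) : AnnealedQuenchedBound :=
  stub_annealedQuenchedBound hM hH

end Summit.CriticalPhenomena.CardyFormulaZ2.Cruxes.IKMixedBoxCrossing.QuenchedChainFKG

end
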